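import Mathlib
import HarnessLib
import Literature.MathematicalPhysics.QuantumLattice.GaugeGroups
import Literature.MathematicalPhysics.QuantumFieldTheory.ConstructiveQFTWave0
import Summits.Ventures.LatticeQCDFlow.Scaling.LatticeEntropySUN
import Summits.Ventures.LatticeQCDFlow.Scaling.LatticeEntropySUNLaw
import Summits.Ventures.LatticeQCDFlow.Scaling.EntropyBudgetMeasure
import Summits.Ventures.LatticeQCDFlow.Scaling.EntropyBudgetFlow
import Summits.Ventures.LatticeQCDFlow.Scaling.EntropyBudgetMeasureSU2
import Summits.Ventures.LatticeQCDFlow.Scaling.EntropyBudgetLayers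

/-!
# LatticeQCDFlow / Scaling — the volume × coupling and DEPTH laws of exact flow samplers for `SU(N)`, all `N ≥ 1`

HONEST FRAMING: exact (Metropolis-corrected) sampling algorithms for lattice gauge theory; figures of merit are
autocorrelation/cost numbers at stated couplings and volumes; no continuum-physics claim.

Venture `LatticeQCDFlow` (cell pub-lqcd), topic `Scaling`, FANOUT row 30 (lean-1) — OUR WORK, five-line corollaries.
Theory-2's `EntropyBudgetMeasureSU2.lean` / `EntropyBudgetLayers.lean` state the ESS budget of exact samplers for
`SU(N)` CONDITIONALLY on `SUN.EntropyGrowthLaw d N` (`SUN.essM_volume_law_of`, `SUN.essM_flow_volume_law_of`) and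
unconditionally only for `SU(2)`.  `Scaling/LatticeEntropySUNLaw.lean` proves `SUN.entropyGrowthLaw d N` for every
`N ≥ 1`; hence, with NO hypothesis left, for every `N ≥ 1`, `d`, `L ≥ 2`, `β ≥ 1`
(`κ_N := N² - 1`, `e(d,L) := (d-1)·L^d·(1/2 - 1/L) - 1/2`):

* `SUN.essM_volume_law`: every model of density `0 < g ≤ C` against product Haar has
  `ESS ≤ C·e^{cL^d}·β^{-κ_N·e(d,L)}`;
* `SUN.essM_flow_volume_law`: every exact flow (Jacobian clamp `1/j ≤ K`, prior density `≤ M`) has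
  `ESS ≤ M·K·e^{cL^d}·β^{-κ_N·e(d,L)}`;
* `SUN.essM_layers_volume_law`: `n` layers with per-layer clamp `K`: `ESS ≤ M·K^n·e^{cL^d}·β^{-κ_N·e(d,L)}`;
* `SUN.depth_lower_bound` (THE DEPTH LAW for `SU(N)`): `ESS ≥ e^{-t}` forces
  `n·log K + log M ≥ κ_N·e(d,L)·log β - c·L^d - t` — for `SU(3)` in `d = 4`: `n·log K + log M ≳ 12·L⁴·log β`.

Elementary given the tree; nothing here is cited as a fact.
-/

noncomputable section

open MeasureTheory InformationTheory
open Literature.MathematicalPhysics.QuantumLattice Literature.MathematicalPhysics.QuantumFieldTheory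

namespace Summit.Ventures.LatticeQCDFlow.Theory2.Lattice

open Summit.Ventures.LatticeQCDFlow.Exactness

/-- **Volume × coupling law for `SU(N)`, unconditional** (OURS; every `N ≥ 1`): models of bounded density.
[folklore] -/
theorem SUN.essM_volume_law (d N : ℕ) (hN : 1 ≤ N) :
    ∃ c : ℝ, ∀ (L : ℕ) [NeZero L], 2 ≤ L → ∀ β : ℝ, 1 ≤ β →
      ∀ (g : GaugeConfig d L (Matrix.specialUnitaryGroup (Fin N) ℂ) → ℝ) (C : ℝ),
        Measurable g → (∀ U, 0 < g U) → (∀ U, g U ≤ C) →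
          essM (wilsonMeasure (d := d) (L := L) (fundamentalRep (Fin N)) β)
              ((Measure.pi fun _ : Edge d L =>
                  haarProbability (Matrix.specialUnitaryGroup (Fin N) ℂ)).withDensity
                fun U => ENNReal.ofReal (g U)) ≤
            C * Real.exp (c * (L : ℝ) ^ d) *
              β ^ (-(((N : ℝ) ^ 2 - 1) *
                (((d : ℝ) - 1) * (L : ℝ) ^ d * (1 / 2 - 1 / L) - 1 / 2))) :=
  SUN.essM_volume_law_of d N (SUN.entropyGrowthLaw d N) hN

/-- **Volume × coupling law for exact FLOW samplers of `SU(N)`, unconditional** (OURS; every `N ≥ 1`).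
[folklore] -/
theorem SUN.essM_flow_volume_law (d N : ℕ) (hN : 1 ≤ N) :
    ∃ c : ℝ, ∀ (L : ℕ) [NeZero L], 2 ≤ L → ∀ β : ℝ, 1 ≤ β →
      ∀ (F : GaugeConfig d L (Matrix.specialUnitaryGroup (Fin N) ℂ) ≃ᵐ
          GaugeConfig d L (Matrix.specialUnitaryGroup (Fin N) ℂ))
        (j r : GaugeConfig d L (Matrix.specialUnitaryGroup (Fin N) ℂ) → ℝ) (K M : ℝ),
        HasJacobian (Measure.pi fun _ : Edge d L =>
            haarProbability (Matrix.specialUnitaryGroup (Fin N) ℂ)) F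
          (fun V => ENNReal.ofReal (j V)) →
        Measurable j → (∀ V, 0 < j V) → (∀ V, (j V)⁻¹ ≤ K) →
        Measurable r → (∀ V, 0 < r V) → (∀ V, r V ≤ M) →
          essM (wilsonMeasure (d := d) (L := L) (fundamentalRep (Fin N)) β)
              (Measure.map F ((Measure.pi fun _ : Edge d L =>
                  haarProbability (Matrix.specialUnitaryGroup (Fin N) ℂ)).withDensity
                fun V => ENNReal.ofReal (r V))) ≤
            M * K * Real.exp (c * (L : ℝ) ^ d) *
              β ^ (-(((N : ℝ) ^ 2 - 1) *
                (((d : ℝ) - 1) * (L : ℝ) ^ d * (1 / 2 - 1 / L) - 1 / 2))) :=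
  SUN.essM_flow_volume_law_of d N (SUN.entropyGrowthLaw d N) hN

/-- **Volume × coupling law for LAYERED exact flow samplers of `SU(N)`, unconditional** (OURS; every
`N ≥ 1`): `n` layers with exact Jacobians and per-layer contraction clamp `K`, prior density `0 < r ≤ M`:
`ESS ≤ M·K^n·e^{cL^d}·β^{-(N²-1)((d-1)L^d(1/2 - 1/L) - 1/2)}`. [folklore] -/
theorem SUN.essM_layers_volume_law (d N : ℕ) (hN : 1 ≤ N) :
    ∃ c : ℝ, ∀ (L : ℕ) [NeZero L], 2 ≤ L → ∀ β : ℝ, 1 ≤ β →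
      ∀ (ls : List ((GaugeConfig d L (Matrix.specialUnitaryGroup (Fin N) ℂ) ≃ᵐ
          GaugeConfig d L (Matrix.specialUnitaryGroup (Fin N) ℂ)) ×
          (GaugeConfig d L (Matrix.specialUnitaryGroup (Fin N) ℂ) → ℝ)))
        (r : GaugeConfig d L (Matrix.specialUnitaryGroup (Fin N) ℂ) → ℝ) (K M : ℝ),
        (∀ l ∈ ls, HasJacobian (Measure.pi fun _ : Edge d L =>
            haarProbability (Matrix.specialUnitaryGroup (Fin N) ℂ)) l.1
          fun V => ENNReal.ofReal (l.2 V)) →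
        (∀ l ∈ ls, Measurable l.2) → (∀ l ∈ ls, ∀ V, 0 < l.2 V) →
        (∀ l ∈ ls, ∀ V, (l.2 V)⁻¹ ≤ K) →
        Measurable r → (∀ V, 0 < r V) → (∀ V, r V ≤ M) →
          essM (wilsonMeasure (d := d) (L := L) (fundamentalRep (Fin N)) β)
              (Measure.map (layersEquiv ls) ((Measure.pi fun _ : Edge d L =>
                  haarProbability (Matrix.specialUnitaryGroup (Fin N) ℂ)).withDensity
                fun V => ENNReal.ofReal (r V))) ≤
            M * K ^ ls.length * Real.exp (c * (L : ℝ) ^ d) *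
              β ^ (-(((N : ℝ) ^ 2 - 1) *
                (((d : ℝ) - 1) * (L : ℝ) ^ d * (1 / 2 - 1 / L) - 1 / 2))) := by
  obtain ⟨c, hc⟩ := SUN.essM_flow_volume_law d N hN
  refine ⟨c, fun L _ hL β hβ ls r K M hJ hm h0 hK hr hr0 hrM => ?_⟩
  exact hc L hL β hβ (layersEquiv ls) (layersJac ls) r (K ^ ls.length) M
    (hasJacobian_layers _ ls hJ h0) (measurable_layersJac ls hm) (layersJac_pos ls h0)
    (layersJac_inv_le ls h0 hK) hr hr0 hrM

/-- **THE DEPTH LAW for `SU(N)`, unconditional** (OURS; every `N ≥ 1`, every `d`): if an exact sampler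
built from `n` layers with per-layer volume-contraction clamp `K` and a prior of density `≤ M` keeps
`ESS ≥ e^{-t}` for the `SU(N)` Wilson measure at coupling `β ≥ 1` on the `L^d` torus (`L ≥ 2`), then
`n·log K + log M ≥ (N²-1)·((d-1)L^d(1/2 - 1/L) - 1/2)·log β - c·L^d - t`: the layer count is extensive in
the volume and logarithmic in `β` at fixed clamp — for `SU(3)`, `d = 4`: `≥ 8·(3L⁴(1/2 - 1/L) - 1/2)·log β - …`.
[folklore] -/
theorem SUN.depth_lower_bound (d N : ℕ) (hN : 1 ≤ N) :
    ∃ c : ℝ, ∀ (L : ℕ) [NeZero L], 2 ≤ L → ∀ β : ℝ, 1 ≤ β →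
      ∀ (ls : List ((GaugeConfig d L (Matrix.specialUnitaryGroup (Fin N) ℂ) ≃ᵐ
          GaugeConfig d L (Matrix.specialUnitaryGroup (Fin N) ℂ)) ×
          (GaugeConfig d L (Matrix.specialUnitaryGroup (Fin N) ℂ) → ℝ)))
        (r : GaugeConfig d L (Matrix.specialUnitaryGroup (Fin N) ℂ) → ℝ) (K M t : ℝ),
        (∀ l ∈ ls, HasJacobian (Measure.pi fun _ : Edge d L =>
            haarProbability (Matrix.specialUnitaryGroup (Fin N) ℂ)) l.1
          fun V => ENNReal.ofReal (l.2 V)) →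
        (∀ l ∈ ls, Measurable l.2) → (∀ l ∈ ls, ∀ V, 0 < l.2 V) →
        (∀ l ∈ ls, ∀ V, (l.2 V)⁻¹ ≤ K) → 0 < K →
        Measurable r → (∀ V, 0 < r V) → (∀ V, r V ≤ M) →
          Real.exp (-t) ≤ essM (wilsonMeasure (d := d) (L := L) (fundamentalRep (Fin N)) β)
              (Measure.map (layersEquiv ls) ((Measure.pi fun _ : Edge d L =>
                  haarProbability (Matrix.specialUnitaryGroup (Fin N) ℂ)).withDensity
                fun V => ENNReal.ofReal (r V))) →
            ((N : ℝ) ^ 2 - 1) * (((d : ℝ) - 1) * (L : ℝ) ^ d * (1 / 2 - 1 / L) - 1 / 2) * Real.log β -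
                c * (L : ℝ) ^ d - t ≤ (ls.length : ℝ) * Real.log K + Real.log M := by
  obtain ⟨c, hc⟩ := SUN.essM_layers_volume_law d N hN
  refine ⟨c, fun L _ hL β hβ ls r K M t hJ hm h0 hK hK0 hr hr0 hrM hess => ?_⟩
  have hβ0 : 0 < β := one_pos.trans_le hβ
  have hM : 0 < M := (hr0 fun _ => 1).trans_le (hrM fun _ => 1)
  have hKn : 0 < K ^ ls.length := pow_pos hK0 _
  have h := hess.trans (hc L hL β hβ ls r K M hJ hm h0 hK hr hr0 hrM)
  have hlog := Real.log_le_log (Real.exp_pos _) h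
  rw [Real.log_exp, Real.log_mul (by positivity) (Real.rpow_pos_of_pos hβ0 _).ne',
    Real.log_mul (by positivity) (Real.exp_pos _).ne', Real.log_mul hM.ne' hKn.ne',
    Real.log_exp, Real.log_rpow hβ0, Real.log_pow] at hlog
  linarith

end Summit.Ventures.LatticeQCDFlow.Theory2.Lattice

end
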